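import Literature.NumberTheory.DiophantineGeometry.GeneralizedFermatTwoPowerCoefficientFreySaitoProofs
import Literature.NumberTheory.EllipticCurves.ThreeTorsionSwanAtTwoClassD4C5C5M2R1M4R1Proofs
import Literature.NumberTheory.EllipticCurves.IsogenyConductorProofs
import Literature.NumberTheory.EllipticCurves.IsogenyTwoTorsionProofs
import Literature.NumberTheory.EllipticCurves.SwanConductorVariableChangeProofs
import HarnessLib

/-!
# Ribet 1997, Theorem 3 — the Swan value of the Frey curve for `4 ∥ B` by a `2`-isogeny

Sibling `Proofs` file (theorems only: no `def`, no named fact, no `sorry`) of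
`Literature.NumberTheory.DiophantineGeometry.GeneralizedFermatTwoPowerCoefficient`
(the named fact `ribet1997_twoPowerFermat`, K. Ribet, *On the equation
`a^p + 2^α b^p + c^p = 0`*, Acta Arith. **79** (1997), 7–16, Theorem 3) and of
`…FreySaitoProofs`, which reduced Theorem 3 to Khare–Wintenberger (`hKW`), Mazur–Kenku (`hMK`),
Serre's weight-two statement (`hwt`) and ONE local input at `2` (`hSw`): for the normalised Frey
curve `E = freyCurve A B : y² = x (x − A) (x + B)`, `A ≡ −1 (mod 4)`, `4 ∣ B`, `16 ∤ B`, the Swan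
conductor of the `3`-torsion at a prime `𝔓 ∣ 2` is `Sw_𝔓(E[3]) = 1` (Ogg's formula at `2` in
Galois form, Silverman *ATAEC* IV.11.1 / Saito 1988, for the two additive Frey classes
`(ord₂ Δ, ord₂ c₄, ord₂ c₆) = (8, 4, 6)` (`4 ∥ B`, Kodaira `I₁*`) and `(10, 4, 6)` (`8 ∥ B`,
`III*`), both with `f₂ = 3`, `δ₂ = 1`; Ribet 1997, §2, p. 11, "`t = 3`", after Diamond–Kramer).

## What is proved here

**The case `4 ∥ B` of `hSw`, unconditionally** (`swanConductorAt_torsion_three_freyCurve_of_four_mul`):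
for `A ≡ −1 (mod 4)`, `B = 4b` with `b` odd, `AB(A+B) ≠ 0`, and every prime `𝔓` of `\bar ℤ`
above the place `2` of `𝓞 ℚ`, `Sw_𝔓(E[3]) = 1`.  The proof is "library-first": it does not compute
in `ℚ(E[3])` at all, but moves the problem along a rational `2`-isogeny into a `2`-adic class for
which the tree already has the Galois-side value.

* The Swan conductor `Sw_𝔓(V_ℓ E)` of the rational Tate module is an **isogeny invariant**
  (`swanConductorAt_rationalTate_eq_of_isogeny`: an isogeny induces a `Γ_ℚ`-isomorphism
  `V_ℓ E ⥲ V_ℓ E'`, `Isogeny.rationalTateModuleEquiv`, Silverman *AEC* III.7.4, and `Sw` is a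
  function of the isomorphism class, `GaloisRep.swanConductorAt_eq_of_equiv`; this is Silverman,
  *ATAEC*, Exercise 4.40, `δ(E/K) = δ(E'/K)`), it is invariant under a change of Weierstrass
  equation (`swanConductorAt_rationalTate_variableChange`), and for `𝔓 ∤ ℓ` it equals the Swan
  conductor of the `ℓ`-torsion (`swanConductorAt_rationalTate_eq_swanConductorAt_torsion`,
  *ATAEC* §IV.10, Definition of `δ`, PDF p. 358).  Hence `Sw_𝔓(E[3]) = Sw_𝔓(E'[3])` for
  `ℚ`-isogenous, or `ℚ`-isomorphic, elliptic curves (`swanConductorAt_torsion_eq_of_isogeny`,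
  `swanConductorAt_torsion_eq_of_smul_eq`).
* Translating `x ↦ x + A` puts the rational `2`-torsion point `(A, 0)` of `E` at the origin:
  `E ≅ W₁ = freyCurve (−A) (A + B) : y² = x (x + A) (x + A + B)`
  (`Ribet1997.smul_freyCurve_eq_freyCurve_neg`), and Silverman's explicit `2`-isogeny with kernel
  `⟨(0, 0)⟩` (*AEC* III.4.5; the tree's `WeierstrassCurve.twoIsogeny`) maps `W₁` onto
  `E₂ = W₁.twoIsogenyCodomain : Y² = X³ − 2(2A + B) X² + B² X`.
* For `A = 4α − 1`, `B = 4(2β + 1)` the invariants of `E₂` are `c₄ = 2⁹ c₄'`, `c₆ = 2¹¹ c₆'`,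
  `Δ = 2¹⁶ A (A + B) (2β+1)⁴` with `c₄'` odd and `c₆' ≡ 1 (mod 4)`
  (`Ribet1997.twoIsogenyCodomain_class_of_four_mul`, stated for the model `C₂ • E₂` rescaled by
  `u = 2`: `(ord₂ Δ, ord₂ c₄, ord₂ c₆) = (4, 5, 5)`), which is exactly the `2`-adic class of the
  tree's theorem `WeierstrassCurve.swanConductorAt_torsion_three_of_class_D4C5C5M2R1M4R1`
  (`Sw_𝔓 = 1`, proved there from the certified fake-point tables).

So `Sw_𝔓(E[3]) = Sw_𝔓(W₁[3]) = Sw_𝔓(E₂[3]) = Sw_𝔓((C₂ • E₂)[3]) = 1`.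

**The case `8 ∥ B` is reduced in the same way** (`swanConductorAt_torsion_three_freyCurve_eq_smul_twoIsogenyCodomain`,
valid for every normalised Frey curve, and the class data `Ribet1997.twoIsogenyCodomain_class_of_eight_mul`):
there `C₂ • E₂` lies in the class `(ord₂ Δ, ord₂ c₄, ord₂ c₆) = (8, 4, 6)` with `c₄' ≡ 5 (mod 8)`,
`c₆' ≡ 1 (mod 4)`, `Δ'` odd — the class of the `4 ∥ B` Frey curves themselves — whose Galois-side
Swan value is not yet a theorem of the tree (nor are the classes `(10, 4, 6)` of `E` itself,
`Ribet1997.freyCurve_class_of_eight_mul`, and `(11, 4, 6)` of the two other `2`-isogenous curves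
`E/⟨(0,0)⟩`, `E/⟨(−B,0)⟩`).  It therefore stays a hypothesis, `hSw₈`, of the final assembly
`ribet1997_twoPowerFermat_of_khare_wintenberger_of_mazurKenku_of_serreWeightTwo_of_freySwanEight`,
which is `…_of_freySwan` (`…FreySaitoProofs`) with `hSw` discharged for `4 ∥ B`.

No new definitions, no new named facts (D-0026); all theorems are proved outright.

## References

* [Ribet1997] K. A. Ribet, Acta Arith. 79 (1997), 7–16: Thm. 3, §2 (p. 11, `t = 3`), §3.
* [SilvermanATAEC1994] J. H. Silverman, *Advanced Topics in the Arithmetic of Elliptic Curves*,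
  GTM 151 (1994): §IV.10 (Definition of `ε, δ, f`, PDF p. 358), Thm. IV.11.1 (Ogg's formula,
  PDF pp. 365–366), Exercise 4.40 (`δ` is an isogeny invariant, PDF p. 380).
* [SilvermanAEC2009] J. H. Silverman, *The Arithmetic of Elliptic Curves*, 2nd ed.: III.4
  Example 4.5 (the explicit `2`-isogeny), III.7.4.
* [Saito1988] T. Saito, Duke Math. J. 57 (1988), Theorem 1.
* [Serre1987] J.-P. Serre, Duke Math. J. 54 (1987), §4.1, §4.6 (4.6.3).
* [KhareWintenberger2009] C. Khare, J.-P. Wintenberger, Invent. Math. 178 (2009), Thm. 1.2.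
-/

noncomputable section

open scoped MatrixGroups ModularForm NumberField
open CongruenceSubgroup UpperHalfPlane Polynomial

namespace Literature.NumberTheory.DiophantineGeometry

open WeierstrassCurve GaloisRepresentations EllipticCurves EllipticCurves.ModularForms
  Rat.HeightOneSpectrum IsDedekindDomain IsDedekindDomain.HeightOneSpectrum Field
  Literature.NumberTheory.Automorphic Literature.NumberTheory.Automorphic.BCDT

attribute [local instance] AddSubgroup.torsionBy.zmodModule

/-! ## Part A. `Sw_𝔓(E[ℓ])` is invariant under `ℚ`-isogenies and changes of equation -/

section General

variable {K : Type*} [Field K] [NumberField K] {W W' : WeierstrassCurve K}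
  [W.IsElliptic] [W'.IsElliptic]

/-- `Sw_𝔓(V_ℓ E') = Sw_𝔓(V_ℓ E)` when `E' = C • E` is obtained from `E` by a change of Weierstrass
equation over `K` (`v ∤ ℓ`, `𝔓 ∣ v`): the `subst` form of
`WeierstrassCurve.swanConductorAt_rationalTate_variableChange` (both sides are
`2 · vol{u > 0 : Γ_K^u(𝔓) moves E[ℓ]}`). [cite: SilvermanATAEC1994, §IV.10 Definition of the conductor (PDF p. 358)] -/
theorem swanConductorAt_rationalTate_eq_of_smul_eq {C : VariableChange K} (e : C • W = W')
    (ℓ : ℕ) [Fact ℓ.Prime]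
    (h : Continuous fun x : absoluteGaloisGroup K × RationalTateModule (geomPoints W) ℓ ↦
      rationalTateRepresentation (absoluteGaloisGroup K) (geomPoints W) ℓ x.1 x.2)
    (h' : Continuous fun x : absoluteGaloisGroup K × RationalTateModule (geomPoints W') ℓ ↦
      rationalTateRepresentation (absoluteGaloisGroup K) (geomPoints W') ℓ x.1 x.2)
    {v : HeightOneSpectrum (𝓞 K)} (hℓ : (ℓ : 𝓞 K) ∉ v.asIdeal)
    {𝔓 : Ideal (absIntegers (𝓞 K) K)} (h𝔓 : 𝔓 ∈ v.primesAbove) :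
    (rationalTateGaloisRepOf (geomPoints W') ℓ h').swanConductorAt (𝓞 K) 𝔓 =
      (rationalTateGaloisRepOf (geomPoints W) ℓ h).swanConductorAt (𝓞 K) 𝔓 := by
  subst e
  exact W.swanConductorAt_rationalTate_variableChange C ℓ h h' hℓ h𝔓

/-- **`Sw_𝔓(V_ℓ E) = Sw_𝔓(V_ℓ E')` for isogenous elliptic curves over a number field**
(unconditionally, at every prime `𝔓` of `\bar ℤ_K`): an isogeny `φ : E → E'` induces a
`Γ_K`-isomorphism `V_ℓ φ : V_ℓ E ⥲ V_ℓ E'` (`Isogeny.rationalTateModuleEquiv`, Silverman *AEC*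
III.7.1(a), III.7.4) and the Swan conductor `∫₀^∞ codim V^{Γ_K^u(𝔓)} du` is a function of the
isomorphism class (`GaloisRep.swanConductorAt_eq_of_equiv`).  This is the `δ`-part of Silverman,
*ATAEC*, Exercise 4.40 ("`δ(E/K) = δ(E'/K)`"), read through §IV.10 (PDF p. 358: the conductor is
defined by the Galois action on torsion); cf. `Isogeny.conductorExponentOf_eq` for `f = ε + δ`.
[cite: SilvermanATAEC1994, Exercise 4.40 (PDF p. 380) with §IV.10 (PDF p. 358)]
[cite: SilvermanAEC2009, III.7.4] -/
theorem swanConductorAt_rationalTate_eq_of_isogeny (φ : Isogeny W W') (ℓ : ℕ) [Fact ℓ.Prime]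
    (h : Continuous fun x : absoluteGaloisGroup K × RationalTateModule (geomPoints W) ℓ ↦
      rationalTateRepresentation (absoluteGaloisGroup K) (geomPoints W) ℓ x.1 x.2)
    (h' : Continuous fun x : absoluteGaloisGroup K × RationalTateModule (geomPoints W') ℓ ↦
      rationalTateRepresentation (absoluteGaloisGroup K) (geomPoints W') ℓ x.1 x.2)
    (𝔓 : Ideal (absIntegers (𝓞 K) K)) :
    (rationalTateGaloisRepOf (geomPoints W) ℓ h).swanConductorAt (𝓞 K) 𝔓 =
      (rationalTateGaloisRepOf (geomPoints W') ℓ h').swanConductorAt (𝓞 K) 𝔓 :=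
  have hℓ : (ℓ : K) ≠ 0 := Nat.cast_ne_zero.2 (Fact.out : ℓ.Prime).ne_zero
  GaloisRep.swanConductorAt_eq_of_equiv (rationalTateGaloisRepOf (geomPoints W) ℓ h)
    (rationalTateGaloisRepOf (geomPoints W') ℓ h') (φ.rationalTateModuleEquiv ℓ hℓ)
    (φ.rationalTateModuleEquiv_smul ℓ hℓ) (𝓞 K) 𝔓

/-- **`Sw_𝔓(E[ℓ]) = Sw_𝔓(E'[ℓ])` for isogenous elliptic curves** (`𝔓 ∣ v ∤ ℓ`): combine
`swanConductorAt_rationalTate_eq_of_isogeny` with `Sw_𝔓(V_ℓ E) = Sw_𝔓(E[ℓ])`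
(`swanConductorAt_rationalTate_eq_swanConductorAt_torsion`, Silverman's definition of `δ(E/K)`
through `E[ℓ]`, *ATAEC* §IV.10, PDF p. 358; the continuity witnesses are
`continuous_rationalGaloisRepTate_holds`).  Note that `φ` need not have degree prime to `ℓ`.
[cite: SilvermanATAEC1994, Exercise 4.40 (PDF p. 380) with §IV.10 (PDF p. 358)] -/
theorem swanConductorAt_torsion_eq_of_isogeny (φ : Isogeny W W') (ℓ : ℕ) [Fact ℓ.Prime]
    {v : HeightOneSpectrum (𝓞 K)} (hℓ : (ℓ : 𝓞 K) ∉ v.asIdeal)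
    {𝔓 : Ideal (absIntegers (𝓞 K) K)} (h𝔓 : 𝔓 ∈ v.primesAbove) :
    (W.torsionGaloisRep ℓ).swanConductorAt (𝓞 K) 𝔓 =
      (W'.torsionGaloisRep ℓ).swanConductorAt (𝓞 K) 𝔓 := by
  rw [← W.swanConductorAt_rationalTate_eq_swanConductorAt_torsion ℓ
      (W.continuous_rationalGaloisRepTate_holds ℓ) hℓ h𝔓,
    ← W'.swanConductorAt_rationalTate_eq_swanConductorAt_torsion ℓ
      (W'.continuous_rationalGaloisRepTate_holds ℓ) hℓ h𝔓]
  exact swanConductorAt_rationalTate_eq_of_isogeny φ ℓ _ _ 𝔓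

/-- **`Sw_𝔓(E[ℓ]) = Sw_𝔓(E'[ℓ])` when `E' = C • E`** is another Weierstrass equation of the same
curve over `K` (`𝔓 ∣ v ∤ ℓ`): `swanConductorAt_rationalTate_eq_of_smul_eq` through
`swanConductorAt_rationalTate_eq_swanConductorAt_torsion`.
[cite: SilvermanATAEC1994, §IV.10 Definition of the conductor (PDF p. 358)] -/
theorem swanConductorAt_torsion_eq_of_smul_eq {C : VariableChange K} (e : C • W = W')
    (ℓ : ℕ) [Fact ℓ.Prime]
    {v : HeightOneSpectrum (𝓞 K)} (hℓ : (ℓ : 𝓞 K) ∉ v.asIdeal)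
    {𝔓 : Ideal (absIntegers (𝓞 K) K)} (h𝔓 : 𝔓 ∈ v.primesAbove) :
    (W.torsionGaloisRep ℓ).swanConductorAt (𝓞 K) 𝔓 =
      (W'.torsionGaloisRep ℓ).swanConductorAt (𝓞 K) 𝔓 := by
  rw [← W.swanConductorAt_rationalTate_eq_swanConductorAt_torsion ℓ
      (W.continuous_rationalGaloisRepTate_holds ℓ) hℓ h𝔓,
    ← W'.swanConductorAt_rationalTate_eq_swanConductorAt_torsion ℓ
      (W'.continuous_rationalGaloisRepTate_holds ℓ) hℓ h𝔓]
  exact (swanConductorAt_rationalTate_eq_of_smul_eq e ℓ _ _ hℓ h𝔓).symm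

end General

/-! ## Part B. The Frey curve: translation to `(A, 0)`, the `2`-isogenous curve, its class -/

section Frey

variable {A B : ℤ}

/-- `3 ∉ v` for a place `v ∋ 2` (`1 = 3 − 2`). [folklore] -/
theorem Ribet1997.three_notMem_of_two_mem {v : HeightOneSpectrum (𝓞 ℚ)}
    (hv2 : (2 : 𝓞 ℚ) ∈ v.asIdeal) : ((3 : ℕ) : 𝓞 ℚ) ∉ v.asIdeal := by
  intro h3v
  have h1 : (1 : 𝓞 ℚ) ∈ v.asIdeal := by
    have e : (1 : 𝓞 ℚ) = ((3 : ℕ) : 𝓞 ℚ) - 2 := by norm_num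
    rw [e]; exact Ideal.sub_mem _ h3v hv2
  exact v.isPrime.ne_top ((Ideal.eq_top_iff_one _).mpr h1)

/-- **Moving the `2`-torsion point `(A, 0)` to the origin**: the change of variables `x ↦ x + A`
(`u = 1`, `r = A`, `s = t = 0`) turns `freyCurve A B : y² = x (x − A) (x + B)` into
`freyCurve (−A) (A + B) : y² = x (x + A) (x + A + B)` (`a₂ = 2A + B`, `a₄ = A (A + B)`), a curve in
two-torsion normal form whose point `T = (0, 0)` is the old `(A, 0)`.
[cite: SilvermanAEC2009, III.4 Example 4.5] [cite: Ribet1997, §2, p. 10] -/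
theorem Ribet1997.smul_freyCurve_eq_freyCurve_neg (A B : ℤ) :
    (⟨1, (A : ℚ), 0, 0⟩ : VariableChange ℚ) • freyCurve A B = freyCurve (-A) (A + B) := by
  ext
  · simp only [variableChange_a₁, freyCurve_a₁]; ring
  · simp only [variableChange_a₂, freyCurve_a₁, freyCurve_a₂]; push_cast; ring
  · simp only [variableChange_a₃, freyCurve_a₁, freyCurve_a₃]; ring
  · simp only [variableChange_a₄, freyCurve_a₁, freyCurve_a₂, freyCurve_a₃, freyCurve_a₄]
    push_cast; ring
  · simp only [variableChange_a₆, freyCurve_a₁, freyCurve_a₂, freyCurve_a₃, freyCurve_a₄,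
      freyCurve_a₆]
    push_cast; ring

/-- **`Sw_𝔓(E[3]) = Sw_𝔓((C • E₂)[3])`** for the Frey curve `E = freyCurve A B` (`AB(A+B) ≠ 0`),
its `2`-isogenous curve `E₂ = (freyCurve (−A) (A + B)).twoIsogenyCodomain :
Y² = X³ − 2(2A + B) X² + B² X` (the quotient of `E` by `⟨(A, 0)⟩`, Silverman *AEC* III.4.5 after
`x ↦ x + A`), any change of equation `C` over `ℚ`, and any prime `𝔓 ∣ 2` of `\bar ℤ`: Part A
(`swanConductorAt_torsion_eq_of_smul_eq`, `swanConductorAt_torsion_eq_of_isogeny`).  This is the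
reduction used below for `4 ∥ B`, and the one to use for `8 ∥ B` once the Galois-side Swan value of
the class of `C₂ • E₂` (`Ribet1997.twoIsogenyCodomain_class_of_eight_mul`) is in the tree.
[cite: SilvermanATAEC1994, Exercise 4.40 (PDF p. 380) with §IV.10 (PDF p. 358)]
[cite: SilvermanAEC2009, III.4 Example 4.5] -/
theorem swanConductorAt_torsion_three_freyCurve_eq_smul_twoIsogenyCodomain
    (h0 : A * B * (A + B) ≠ 0) (C : VariableChange ℚ)
    {v : HeightOneSpectrum (𝓞 ℚ)} (hv2 : (2 : 𝓞 ℚ) ∈ v.asIdeal)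
    {𝔓 : Ideal (absIntegers (𝓞 ℚ) ℚ)} (h𝔓 : 𝔓 ∈ v.primesAbove) :
    ((freyCurve A B).torsionGaloisRep 3).swanConductorAt (𝓞 ℚ) 𝔓 =
      ((C • (freyCurve (-A) (A + B)).twoIsogenyCodomain).torsionGaloisRep 3).swanConductorAt
        (𝓞 ℚ) 𝔓 := by
  classical
  haveI : Fact (Nat.Prime 3) := ⟨Nat.prime_three⟩
  haveI hE : (freyCurve A B).IsElliptic := isElliptic_freyCurve h0
  have h3 := Ribet1997.three_notMem_of_two_mem hv2
  have h0' : (-A) * (A + B) * (-A + (A + B)) ≠ 0 := by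
    have e : (-A) * (A + B) * (-A + (A + B)) = -(A * B * (A + B)) := by ring
    rw [e]; exact neg_ne_zero.mpr h0
  haveI hW₁ : (freyCurve (-A) (A + B)).IsElliptic := isElliptic_freyCurve h0'
  haveI : (freyCurve (-A) (A + B)).IsTwoTorsionNF := ⟨rfl, rfl, rfl⟩
  rw [swanConductorAt_torsion_eq_of_smul_eq (Ribet1997.smul_freyCurve_eq_freyCurve_neg A B) 3 h3 h𝔓,
    swanConductorAt_torsion_eq_of_isogeny (freyCurve (-A) (A + B)).twoIsogeny 3 h3 h𝔓,
    swanConductorAt_torsion_eq_of_smul_eq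
      (rfl : C • (freyCurve (-A) (A + B)).twoIsogenyCodomain =
        C • (freyCurve (-A) (A + B)).twoIsogenyCodomain) 3 h3 h𝔓]

/-- **Class data of `C₂ • E₂` for `4 ∥ B`.**  For `A = 4α − 1`, `B = 4(2β + 1)` and the curve
`E₂ = (freyCurve (−A) (A + B)).twoIsogenyCodomain : Y² = X³ − 2(2A + B) X² + B² X` rescaled by
`u = 2` (`C₂ = ⟨2, 0, 0, 0⟩`): `c₄ = 2⁵ c₄'`, `c₆ = 2⁵ c₆'`, `Δ = 2⁴ Δ'` with the explicit odd
`c₄' = 2(4α² + 2α + 8αβ + β² − β − 1) + 1`, `c₆' = m (2m² − 9(2β+1)²)`, `m = 4(α + β) + 1` (so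
`c₆' ≡ 1 (mod 4)`), `Δ' = A (A + B) (2β + 1)⁴` — the class `(ord₂ Δ, ord₂ c₄, ord₂ c₆) = (4, 5, 5)`,
`c₆' ≡ 1 (mod 4)` of `swanConductorAt_torsion_three_of_class_D4C5C5M2R1M4R1`.  (Unscaled:
`c₄(E₂) = 16(16A² + 16AB + B²)`, `c₆(E₂) = 64(2A + B)(8(2A + B)² − 9B²)`,
`Δ(E₂) = 256 A (A + B) B⁴`, Silverman *AEC* III.1 and III.4.5.) [cite: SilvermanAEC2009, III.1 and III.4 Example 4.5] -/
theorem Ribet1997.twoIsogenyCodomain_class_of_four_mul {α β : ℤ} (hA : A = 4 * α - 1)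
    (hB : B = 4 * (2 * β + 1)) :
    ((⟨Units.mk0 2 two_ne_zero, 0, 0, 0⟩ : VariableChange ℚ) •
          (freyCurve (-A) (A + B)).twoIsogenyCodomain).c₄ =
        (2 : ℚ) ^ 5 * ((2 * (4 * α ^ 2 + 2 * α + 8 * α * β + β ^ 2 - β - 1) + 1 : ℤ) : ℚ) ∧
      ((⟨Units.mk0 2 two_ne_zero, 0, 0, 0⟩ : VariableChange ℚ) •
          (freyCurve (-A) (A + B)).twoIsogenyCodomain).c₆ =
        (2 : ℚ) ^ 5 *
          (((4 * (α + β) + 1) * (2 * (4 * (α + β) + 1) ^ 2 - 9 * (2 * β + 1) ^ 2) : ℤ) : ℚ) ∧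
      ((⟨Units.mk0 2 two_ne_zero, 0, 0, 0⟩ : VariableChange ℚ) •
          (freyCurve (-A) (A + B)).twoIsogenyCodomain).Δ =
        (2 : ℚ) ^ 4 * ((A * (A + B) * (2 * β + 1) ^ 4 : ℤ) : ℚ) := by
  have hu : ((((⟨Units.mk0 2 two_ne_zero, 0, 0, 0⟩ : VariableChange ℚ)).u⁻¹ : ℚˣ) : ℚ) = 2⁻¹ := by
    simp
  refine ⟨?_, ?_, ?_⟩
  · rw [variableChange_c₄, hu]
    simp only [WeierstrassCurve.c₄, WeierstrassCurve.b₂, WeierstrassCurve.b₄, twoIsogenyCodomain_a₁,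
      twoIsogenyCodomain_a₂, twoIsogenyCodomain_a₃, twoIsogenyCodomain_a₄, freyCurve_a₂,
      freyCurve_a₄, hA, hB]
    push_cast; ring
  · rw [variableChange_c₆, hu]
    simp only [WeierstrassCurve.c₆, WeierstrassCurve.b₂, WeierstrassCurve.b₄, WeierstrassCurve.b₆,
      twoIsogenyCodomain_a₁, twoIsogenyCodomain_a₂, twoIsogenyCodomain_a₃, twoIsogenyCodomain_a₄,
      twoIsogenyCodomain_a₆, freyCurve_a₂, freyCurve_a₄, hA, hB]
    push_cast; ring
  · rw [variableChange_Δ, hu, twoIsogenyCodomain_Δ]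
    simp only [freyCurve_a₂, freyCurve_a₄, hA, hB]
    push_cast; ring

/-- **Class data of `C₂ • E₂` for `8 ∥ B`** (for the future plug-in of `hSw₈`).  For `A = 4α − 1`,
`B = 8(2β + 1)` and `E₂ = (freyCurve (−A) (A + B)).twoIsogenyCodomain` rescaled by `u = 2`:
`c₄ = 2⁴ c₄'`, `c₆ = 2⁶ c₆'`, `Δ = 2⁸ Δ'` with `c₄' = A² + 8A(2β+1) + 4(2β+1)²` (so
`c₄' ≡ 5 (mod 8)`), `c₆' = m (m² − 18(2β+1)²)`, `m = 4(α + 2β) + 3` (so `c₆' ≡ 1 (mod 4)`),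
`Δ' = A (A + B) (2β+1)⁴` odd: the class `(ord₂ Δ, ord₂ c₄, ord₂ c₆) = (8, 4, 6)`,
`c₄' ≡ 5 (mod 8)` — the class of the `4 ∥ B` Frey curves (`Ribet1997.freyCurve_class_of_four_mul`),
whose Galois-side Swan value (`= 1` by Ogg–Saito) is not yet in the tree.
[cite: SilvermanAEC2009, III.1 and III.4 Example 4.5] [cite: Ribet1997, §2, p. 11] -/
theorem Ribet1997.twoIsogenyCodomain_class_of_eight_mul {α β : ℤ} (hA : A = 4 * α - 1)
    (hB : B = 8 * (2 * β + 1)) :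
    ((⟨Units.mk0 2 two_ne_zero, 0, 0, 0⟩ : VariableChange ℚ) •
          (freyCurve (-A) (A + B)).twoIsogenyCodomain).c₄ =
        (2 : ℚ) ^ 4 * ((A ^ 2 + 8 * A * (2 * β + 1) + 4 * (2 * β + 1) ^ 2 : ℤ) : ℚ) ∧
      ((⟨Units.mk0 2 two_ne_zero, 0, 0, 0⟩ : VariableChange ℚ) •
          (freyCurve (-A) (A + B)).twoIsogenyCodomain).c₆ =
        (2 : ℚ) ^ 6 *
          (((4 * (α + 2 * β) + 3) * ((4 * (α + 2 * β) + 3) ^ 2 - 18 * (2 * β + 1) ^ 2) : ℤ) : ℚ) ∧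
      ((⟨Units.mk0 2 two_ne_zero, 0, 0, 0⟩ : VariableChange ℚ) •
          (freyCurve (-A) (A + B)).twoIsogenyCodomain).Δ =
        (2 : ℚ) ^ 8 * ((A * (A + B) * (2 * β + 1) ^ 4 : ℤ) : ℚ) ∧
      (A ^ 2 + 8 * A * (2 * β + 1) + 4 * (2 * β + 1) ^ 2) % 8 = 5 ∧
      ((4 * (α + 2 * β) + 3) * ((4 * (α + 2 * β) + 3) ^ 2 - 18 * (2 * β + 1) ^ 2)) % 4 = 1 := by
  have hu : ((((⟨Units.mk0 2 two_ne_zero, 0, 0, 0⟩ : VariableChange ℚ)).u⁻¹ : ℚˣ) : ℚ) = 2⁻¹ := by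
    simp
  refine ⟨?_, ?_, ?_, ?_, ?_⟩
  · rw [variableChange_c₄, hu]
    simp only [WeierstrassCurve.c₄, WeierstrassCurve.b₂, WeierstrassCurve.b₄, twoIsogenyCodomain_a₁,
      twoIsogenyCodomain_a₂, twoIsogenyCodomain_a₃, twoIsogenyCodomain_a₄, freyCurve_a₂,
      freyCurve_a₄, hB]
    push_cast; ring
  · rw [variableChange_c₆, hu]
    simp only [WeierstrassCurve.c₆, WeierstrassCurve.b₂, WeierstrassCurve.b₄, WeierstrassCurve.b₆,
      twoIsogenyCodomain_a₁, twoIsogenyCodomain_a₂, twoIsogenyCodomain_a₃, twoIsogenyCodomain_a₄,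
      twoIsogenyCodomain_a₆, freyCurve_a₂, freyCurve_a₄, hA, hB]
    push_cast; ring
  · rw [variableChange_Δ, hu, twoIsogenyCodomain_Δ]
    simp only [freyCurve_a₂, freyCurve_a₄, hA, hB]
    push_cast; ring
  · have e : A ^ 2 + 8 * A * (2 * β + 1) + 4 * (2 * β + 1) ^ 2 =
        8 * (2 * α ^ 2 - α + (4 * α - 1) * (2 * β + 1) + 2 * β ^ 2 + 2 * β) + 5 := by
      rw [hA]; ring
    rw [e]; omega
  · have e : (4 * (α + 2 * β) + 3) * ((4 * (α + 2 * β) + 3) ^ 2 - 18 * (2 * β + 1) ^ 2) =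
        4 * ((α + 2 * β) * (16 * (α + 2 * β) ^ 2 + 24 * (α + 2 * β) + 9 - 18 * (2 * β + 1) ^ 2) +
          12 * (α + 2 * β) ^ 2 + 18 * (α + 2 * β) - 54 * β ^ 2 - 54 * β - 7) + 1 := by
      ring
    rw [e]; omega

/-- **`Sw_𝔓(E[3]) = 1` for the Frey curve with `4 ∥ B` — the `(8, 4, 6)` half of `hSw`,
unconditionally.**  For `E = freyCurve A B : y² = x (x − A) (x + B)` with `A ≡ −1 (mod 4)`,
`B = 4b`, `b` odd, `AB(A+B) ≠ 0`, every place `v ∋ 2` of `𝓞 ℚ` and every prime `𝔓 ∣ v` of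
`\bar ℤ`: the Swan conductor of the `3`-torsion representation at `𝔓` is `1`.  Proof:
`Sw_𝔓(E[3]) = Sw_𝔓((C₂ • E₂)[3])`
(`swanConductorAt_torsion_three_freyCurve_eq_smul_twoIsogenyCodomain`: isogeny and isomorphism
invariance, *ATAEC* Ex. 4.40), and `C₂ • E₂` lies in the `2`-adic class `(4, 5, 5)`,
`c₆' ≡ 1 (mod 4)` (`Ribet1997.twoIsogenyCodomain_class_of_four_mul`), where the tree's theorem
`swanConductorAt_torsion_three_of_class_D4C5C5M2R1M4R1` (the Galois side of Ogg's formula at `2`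
for that class, *ATAEC* IV.11.1) gives the value `1`.  This agrees with Ogg's formula for `E`
itself: Kodaira type `I₁*` at `2`, `f₂ = 3`, `δ₂ = 1` (`wildConductorExponent_freyCurve_two_eq_one`;
Ribet 1997, §2, p. 11, `t = 3`). [cite: Ribet1997, §2, p. 11]
[cite: SilvermanATAEC1994, Thm. IV.11.1 (PDF pp. 365–366) and Exercise 4.40 (p. 380)]
[cite: SilvermanAEC2009, III.4 Example 4.5] -/
theorem swanConductorAt_torsion_three_freyCurve_of_four_mul (h0 : A * B * (A + B) ≠ 0)
    (hA : A ≡ -1 [ZMOD 4]) {b : ℤ} (hB : B = 4 * b) (hb : Odd b)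
    {v : HeightOneSpectrum (𝓞 ℚ)} (hv2 : (2 : 𝓞 ℚ) ∈ v.asIdeal)
    {𝔓 : Ideal (absIntegers (𝓞 ℚ) ℚ)} (h𝔓 : 𝔓 ∈ v.primesAbove) :
    ((freyCurve A B).torsionGaloisRep 3).swanConductorAt (𝓞 ℚ) 𝔓 = 1 := by
  classical
  have h0' : (-A) * (A + B) * (-A + (A + B)) ≠ 0 := by
    have e : (-A) * (A + B) * (-A + (A + B)) = -(A * B * (A + B)) := by ring
    rw [e]; exact neg_ne_zero.mpr h0
  haveI hW₁ : (freyCurve (-A) (A + B)).IsElliptic := isElliptic_freyCurve h0'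
  haveI : (freyCurve (-A) (A + B)).IsTwoTorsionNF := ⟨rfl, rfl, rfl⟩
  have hA' : A % 4 = 3 := by unfold Int.ModEq at hA; omega
  obtain ⟨α, hα⟩ : ∃ α, A = 4 * α - 1 := ⟨A / 4 + 1, by omega⟩
  obtain ⟨β, hβ⟩ := hb
  have hB' : B = 4 * (2 * β + 1) := by rw [hB, hβ]
  obtain ⟨hc4, hc6, hΔ⟩ := Ribet1997.twoIsogenyCodomain_class_of_four_mul hα hB'
  rw [swanConductorAt_torsion_three_freyCurve_eq_smul_twoIsogenyCodomain h0
    (⟨Units.mk0 2 two_ne_zero, 0, 0, 0⟩ : VariableChange ℚ) hv2 h𝔓]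
  refine swanConductorAt_torsion_three_of_class_D4C5C5M2R1M4R1 _ hv2 h𝔓 hc4 hc6 hΔ (by omega) ?_
  have e6 : (4 * (α + β) + 1) * (2 * (4 * (α + β) + 1) ^ 2 - 9 * (2 * β + 1) ^ 2) =
      4 * (4 * (α + β) * (8 * (α + β) ^ 2 + 4 * (α + β) - 9 * β ^ 2 - 9 * β - 2) + (α + β) +
        (8 * (α + β) ^ 2 + 4 * (α + β) - 9 * β ^ 2 - 9 * β - 2)) + 1 := by ring
  rw [e6]; omega

/-- The `∃ 𝔓`-form of `swanConductorAt_torsion_three_freyCurve_of_four_mul` at the place of `𝓞 ℚ`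
above `2` named as in `hSw` (`(primesEquiv (R := 𝓞 ℚ)).symm ⟨2, _⟩`; a prime above it exists,
`HeightOneSpectrum.primesAbove_nonempty`), under the hypotheses of `hSw` (`4 ∣ B`, `16 ∤ B`) and
`8 ∤ B`. [cite: Ribet1997, §2, p. 11] -/
theorem exists_swanConductorAt_torsion_three_freyCurve_of_not_eight_dvd (h0 : A * B * (A + B) ≠ 0)
    (hA : A ≡ -1 [ZMOD 4]) (h4 : (4 : ℤ) ∣ B) (h8 : ¬ (8 : ℤ) ∣ B) :
    ∃ 𝔓 ∈ ((primesEquiv (R := 𝓞 ℚ)).symm ⟨2, Nat.prime_two⟩).primesAbove,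
      ((freyCurve A B).torsionGaloisRep 3).swanConductorAt (𝓞 ℚ) 𝔓 = 1 := by
  have h2 : (2 : 𝓞 ℚ) ∈ ((primesEquiv (R := 𝓞 ℚ)).symm ⟨2, Nat.prime_two⟩).asIdeal := by
    have := (natCast_mem_asIdeal_iff_primesEquiv_eq
      ((primesEquiv (R := 𝓞 ℚ)).symm ⟨2, Nat.prime_two⟩) Nat.prime_two).mpr
      (by rw [Equiv.apply_symm_apply])
    exact_mod_cast this
  obtain ⟨b, hb⟩ := h4
  have hbodd : Odd b := by
    rcases Int.even_or_odd b with ⟨c, hc⟩ | hodd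
    · exact absurd ⟨c, by rw [hb, hc]; ring⟩ h8
    · exact hodd
  exact ⟨_, (HeightOneSpectrum.primesAbove_nonempty _).some_mem,
    swanConductorAt_torsion_three_freyCurve_of_four_mul h0 hA hb hbodd h2
      (HeightOneSpectrum.primesAbove_nonempty _).some_mem⟩

end Frey

/-! ## Part C. The Serre-road assembly with the Swan input asked only for `8 ∥ B` -/

section SerreRoad

open ValuativeRel GaloisRepresentations.ModPGaloisRep GaloisRepresentations.IsNonarchimedeanLocalField

/-- **Ribet 1997, Theorem 3 ⟸ Khare–Wintenberger ∧ Mazur–Kenku ∧ Serre's weight-two statement ∧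
ONE Swan value `Sw_𝔓(E[3]) = 1` for the Frey curves with `8 ∥ B`.**  This is
`ribet1997_twoPowerFermat_of_khare_wintenberger_of_mazurKenku_of_serreWeightTwo_of_freySwan`
(`…FreySaitoProofs`, whose docstring describes the printed proof being followed — Ribet 1997 §3 in
Serre's language: normalise, frame `E[p]`, irreducible and odd, Khare–Wintenberger in weight `2`,
level `N ∣ 8`, `S₂(Γ₀(8)) = 0`) with its local input `hSw` DISCHARGED for `4 ∥ B`
(`exists_swanConductorAt_torsion_three_freyCurve_of_not_eight_dvd`, by the `2`-isogeny to the
class `(4, 5, 5)`), leaving `hSw₈`: for `A ≡ −1 (mod 4)`, `8 ∣ B`, `16 ∤ B`, `A, B` coprime,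
`AB(A+B) ≠ 0`, some prime `𝔓` above `2` has `Sw_𝔓((freyCurve A B)[3]) = 1` — an instance of Ogg's
formula at `2` in Galois form (Kodaira `III*`, `δ₂ = 1`; the classes `(10, 4, 6)`, `c₄' ≡ 1 (mod 8)`
of `E`, equivalently `(8, 4, 6)`, `c₄' ≡ 5 (mod 8)` of `C₂ • E₂` by
`swanConductorAt_torsion_three_freyCurve_eq_smul_twoIsogenyCodomain`).  Remaining hypotheses:
`hKW` (named fact `khare_wintenberger`, Khare–Wintenberger 2009, Thm. 1.2), `hMK` (named fact
`mazurKenku_exists_cyclic_isogeny`, Mazur 1978 + Kenku), `hwt` (Serre 1987, §2.9 Prop. 5 with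
(4.1.11): `k(ρ̄_{E,p} ⊗ k) = 2` at a semistable `p ≥ 5` with `p ∣ ord_p Δ_min`; not catalogued),
`hSw₈`. [cite: Ribet1997, Thm. 3, §2 (p. 11) and §3 (p. 13)]
[cite: Serre1987, §2.9 Prop. 5, §4.1 (4.1.11)–(4.1.12), (4.6.3)] [cite: KhareWintenberger2009, Thm. 1.2]
[cite: SilvermanATAEC1994, Thm. IV.11.1 (PDF pp. 365–366), Exercise 4.40 (p. 380)] [cite: Saito1988, Theorem 1] -/
theorem ribet1997_twoPowerFermat_of_khare_wintenberger_of_mazurKenku_of_serreWeightTwo_of_freySwanEight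
    (hKW : ∀ (p : ℕ) [Fact p.Prime] (k : Type) [Field k] [TopologicalSpace k] [DiscreteTopology k],
      khare_wintenberger p k)
    (hMK : mazurKenku_exists_cyclic_isogeny)
    (hwt : ∀ (W : WeierstrassCurve ℚ) [W.IsElliptic] (p : ℕ) [Fact p.Prime], 5 ≤ p →
      W.IsSemistableAt ((primesEquiv (R := ℤ)).symm ⟨p, Fact.out⟩) →
      p ∣ W.ordMinimalDiscriminant ((primesEquiv (R := ℤ)).symm ⟨p, Fact.out⟩) →
      ∀ ρ : ModPGaloisRep ℚ (ZMod p) 2, W.IsTorsionGaloisRep p ρ →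
        ∀ (k : Type) [Field k] [TopologicalSpace k] [DiscreteTopology k] [CharP k p]
          [IsAlgClosed k] (j : ZMod p →+* k)
          (loc : LocalRestrictionAt p (FramedRep.baseChange j continuous_of_discreteTopology ρ))
          (ι : absIntegers 𝒪[loc.F] loc.F ⧸ absMaximalIdeal loc.F →+* k),
          serreWeight p (FramedRep.baseChange j continuous_of_discreteTopology ρ) loc ι = 2)
    (hSw₈ : ∀ (A B : ℤ), IsCoprime A B → A * B * (A + B) ≠ 0 → A ≡ -1 [ZMOD 4] → (8 : ℤ) ∣ B →
      ¬ (16 : ℤ) ∣ B →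
        ∃ 𝔓 ∈ ((primesEquiv (R := 𝓞 ℚ)).symm ⟨2, Nat.prime_two⟩).primesAbove,
          ((freyCurve A B).torsionGaloisRep 3).swanConductorAt (𝓞 ℚ) 𝔓 = 1) :
    ribet1997_twoPowerFermat :=
  ribet1997_twoPowerFermat_of_khare_wintenberger_of_mazurKenku_of_serreWeightTwo_of_freySwan hKW hMK
    hwt fun A B hcop h0 hA h4 h16 ↦ by
      by_cases h8 : (8 : ℤ) ∣ B
      · exact hSw₈ A B hcop h0 hA h8 h16
      · exact exists_swanConductorAt_torsion_three_freyCurve_of_not_eight_dvd h0 hA h4 h8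

end SerreRoad

end Literature.NumberTheory.DiophantineGeometry
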